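import Summits.ValiantsHypothesis.ValiantsHypothesis.Theorems.NewtonFramesTwoProductsFrameRungTwoBinomialFrames

/-!
# Crux `TwoProducts` (stmt-5906), line `FrameRungTwo`: the rigidity lemma for two dissociated binomial frames

Second of three files (tools: `…BinomialFrames.lean`; count: `…Binomial.lean`).  Setting: a functional `l`, two
tuples `f, g` of binomial factors on dissociated frames with presentations `T, lo` / `T', lo'`, and an exponent
`e` such that every exponent `x ≠ e` with `l e ≤ l x` is cancelled in `Π f + Π g` (what a strictly exposing
functional at a vertex provides), the top word sums being equal and key-above `e` (`top_eq`).

* `step` / `matched_of_small` — **RIGIDITY**: every one-letter demotion `T − gap_j` of EITHER frame that stays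
  key-above `e` is a one-letter demotion of the OTHER frame, with the same gap and the same coefficient ratio
  `c(lo)/c(T)`.  Induction down the key order (a key-maximal unmatched demotion point is a cancelled exponent,
  hence a word of the other frame; if that word demoted `≥ 2` letters, those are already matched (`transfer`),
  and the point would be a second word of its own frame with the same sum — excluded by dissociation).
* `card_filter_le_one` — consequently a word of `f` whose sum is the (uncancelled) exponent `e` demotes AT MOST
  ONE letter of the top tuple (two demoted letters transfer to a `g`-word with the cancelling coefficient).

For `t = 3` the induction breaks exactly at in-coordinate carries (`{0,1,2}⊕{0,3,6}` vs `{0,1,6}⊕{0,2,4}` agree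
below `7 = 1 + 6`), which is the open content of the stub.  Nothing here bears on `VP ≠ VNP`.
[ours; setting KPTT arXiv:1308.2286 §2, §5]
-/

set_option linter.dupNamespace false

namespace Summit.ValiantsHypothesis.ValiantsHypothesis.Theorems.NewtonFramesTwoProducts.FrameRungTwoBinomial

open MvPolynomial
open scoped BigOperators Classical
open Summit.ValiantsHypothesis.Theorems.DissociatedFixedK (lexKey lexKey_injective lexTop lexTop_mem lexKey_le_lexTop
  eq_lexTop_of_forall_le stub_topTupleCount count_arith coeff_sum_prod_of_dissociated exists_word_of_mem_support)
open Summit.ValiantsHypothesis.ValiantsHypothesis.Theorems.DissociatedFixedK.Negative (emb emb_injective)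

noncomputable section

section Rigidity

variable {m : ℕ}

/-- **Transfer of a demotion set through a matching.**  If the one-letter demotions of `g` at the coordinates
`W` are one-letter demotions of `f` at `σ i` (`i ∈ W`), then `σ` is injective on `W`, and some `f`-word
demoting exactly `σ '' W` has the top sum with the same gaps removed. -/
theorem transfer (f g : Fin m → MvPolynomial (Fin 2) ℂ) (T lo T' lo' : Fin m → (Fin 2 →₀ ℕ))
    (hT : ∀ j, T j ∈ (f j).support) (hlo : ∀ j, lo j ∈ (f j).support)
    (hcov : ∀ j, ∀ x ∈ (f j).support, x = T j ∨ x = lo j)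
    (hT' : ∀ j, T' j ∈ (g j).support) (hlo' : ∀ j, lo' j ∈ (g j).support)
    (hcov' : ∀ j, ∀ x ∈ (g j).support, x = T' j ∨ x = lo' j)
    (hinjg : ∀ a b : Fin m → (Fin 2 →₀ ℕ), (∀ j, a j ∈ (g j).support) → (∀ j, b j ∈ (g j).support) →
      ∑ j, a j = ∑ j, b j → a = b)
    (htop : ∑ j, T j = ∑ j, T' j)
    (W : Finset (Fin m)) (σ : Fin m → Fin m) (hW : ∀ i ∈ W, lo' i ≠ T' i)
    (hσ : ∀ i ∈ W, lo (σ i) ≠ T (σ i) ∧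
      ∑ i', Function.update T' i (lo' i) i' = ∑ i', Function.update T (σ i) (lo (σ i)) i') :
    Set.InjOn σ W ∧ ∃ a : Fin m → (Fin 2 →₀ ℕ), (∀ i', a i' ∈ (f i').support) ∧
      (Finset.univ.filter fun i' => a i' ≠ T i') = W.image σ ∧
      emb (∑ i', a i') = emb (∑ j, T' j) - ∑ i ∈ W, (emb (T' i) - emb (lo' i)) := by
  classical
  -- gaps agree
  have hgap : ∀ i ∈ W, emb (T' i) - emb (lo' i) = emb (T (σ i)) - emb (lo (σ i)) := by
    intro i hi
    have h1 := emb_sum_update g T' lo' hT' hlo' hcov' (hW i hi)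
    have h2 := emb_sum_update f T lo hT hlo hcov (hσ i hi).1
    rw [(hσ i hi).2, h2, htop] at h1
    exact (sub_right_inj.1 h1).symm
  -- injectivity
  have hinj : Set.InjOn σ W := by
    intro i₁ hi₁ i₂ hi₂ hσeq
    have hs : ∑ i', Function.update T' i₁ (lo' i₁) i' = ∑ i', Function.update T' i₂ (lo' i₂) i' := by
      rw [(hσ i₁ hi₁).2, (hσ i₂ hi₂).2, hσeq]
    exact update_sum_injective g T' lo' hT' hlo' hinjg (hW i₁ hi₁) hs
  -- the transferred word (kept abstract through its pointwise specification)
  have key : ∀ a : Fin m → (Fin 2 →₀ ℕ), (∀ i', a i' = if i' ∈ W.image σ then lo i' else T i') →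
      (∀ i', a i' ∈ (f i').support) ∧ (Finset.univ.filter fun i' => a i' ≠ T i') = W.image σ ∧
      emb (∑ i', a i') = emb (∑ j, T' j) - ∑ i ∈ W, (emb (T' i) - emb (lo' i)) := by
    intro a ha
    have hamem : ∀ i', a i' ∈ (f i').support := by
      intro i'; rw [ha i']; split_ifs
      · exact hlo i'
      · exact hT i'
    have hdset : (Finset.univ.filter fun i' => a i' ≠ T i') = W.image σ := by
      ext i'
      rw [Finset.mem_filter, ha i']
      simp only [Finset.mem_univ, true_and]
      constructor
      · intro h; by_contra hni; rw [if_neg hni] at h; exact h rfl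
      · intro h; rw [if_pos h]
        obtain ⟨i, hi, rfl⟩ := Finset.mem_image.1 h
        exact (hσ i hi).1
    refine ⟨hamem, hdset, ?_⟩
    rw [emb_sum_word f T lo hcov hamem, hdset, htop, Finset.sum_image hinj]
    congr 1
    exact Finset.sum_congr rfl fun i hi => (hgap i hi).symm
  exact ⟨hinj, _, key (fun i' => if i' ∈ W.image σ then lo i' else T i') (fun i' => rfl)⟩

/-- The top word sum is cancelled: `c_A + c_B = 0` for the two top coefficients. -/
theorem topCoeff_add_eq_zero (l : (Fin 2 → ℝ) →L[ℝ] ℝ) (f g : Fin m → MvPolynomial (Fin 2) ℂ)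
    (T T' : Fin m → (Fin 2 →₀ ℕ)) (hT : ∀ j, T j ∈ (f j).support) (hT' : ∀ j, T' j ∈ (g j).support)
    (hinjf : ∀ a b : Fin m → (Fin 2 →₀ ℕ), (∀ j, a j ∈ (f j).support) → (∀ j, b j ∈ (f j).support) →
      ∑ j, a j = ∑ j, b j → a = b)
    (hinjg : ∀ a b : Fin m → (Fin 2 →₀ ℕ), (∀ j, a j ∈ (g j).support) → (∀ j, b j ∈ (g j).support) →
      ∑ j, a j = ∑ j, b j → a = b)
    (e : Fin 2 →₀ ℕ)
    (hzero : ∀ x : Fin 2 →₀ ℕ, x ≠ e → l (emb e) ≤ l (emb x) → coeff x (∏ j, f j) + coeff x (∏ j, g j) = 0)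
    (htop : ∑ j, T j = ∑ j, T' j) (hTe : lexKey l e < lexKey l (∑ j, T j)) :
    (∏ j, coeff (T j) (f j)) + ∏ j, coeff (T' j) (g j) = 0 := by
  have hne : (∑ j, T j) ≠ e := fun h => by rw [h] at hTe; exact lt_irrefl _ hTe
  have hz := hzero _ hne (apply_le_of_lexKey_le l hTe.le)
  rw [coeff_word f hinjf _ hT] at hz
  rw [htop, coeff_word g hinjg _ hT'] at hz
  exact hz

/-- **Step 2 (one induction step of the rigidity lemma), `f`-side.**  A one-letter demotion point `x` of `f`
key-above `e` is a one-letter demotion point of `g` with the same coefficient ratio, provided every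
one-letter demotion point of `g` key-above `x` is already known to be a one-letter demotion point of `f`. -/
theorem step (l : (Fin 2 → ℝ) →L[ℝ] ℝ) (f g : Fin m → MvPolynomial (Fin 2) ℂ) (T lo T' lo' : Fin m → (Fin 2 →₀ ℕ))
    (hT : ∀ j, T j ∈ (f j).support) (hlo : ∀ j, lo j ∈ (f j).support)
    (hTmax : ∀ j, ∀ x ∈ (f j).support, lexKey l x ≤ lexKey l (T j))
    (hcov : ∀ j, ∀ x ∈ (f j).support, x = T j ∨ x = lo j)
    (hT' : ∀ j, T' j ∈ (g j).support) (hlo' : ∀ j, lo' j ∈ (g j).support)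
    (hTmax' : ∀ j, ∀ x ∈ (g j).support, lexKey l x ≤ lexKey l (T' j))
    (hcov' : ∀ j, ∀ x ∈ (g j).support, x = T' j ∨ x = lo' j)
    (hinjf : ∀ a b : Fin m → (Fin 2 →₀ ℕ), (∀ j, a j ∈ (f j).support) → (∀ j, b j ∈ (f j).support) →
      ∑ j, a j = ∑ j, b j → a = b)
    (hinjg : ∀ a b : Fin m → (Fin 2 →₀ ℕ), (∀ j, a j ∈ (g j).support) → (∀ j, b j ∈ (g j).support) →
      ∑ j, a j = ∑ j, b j → a = b)
    (e : Fin 2 →₀ ℕ)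
    (hzero : ∀ x : Fin 2 →₀ ℕ, x ≠ e → l (emb e) ≤ l (emb x) → coeff x (∏ j, f j) + coeff x (∏ j, g j) = 0)
    (htop : ∑ j, T j = ∑ j, T' j) (hTe : lexKey l e < lexKey l (∑ j, T j))
    {x : Fin 2 →₀ ℕ} {j : Fin m} (hj : lo j ≠ T j) (hx : x = ∑ i, Function.update T j (lo j) i)
    (hex : lexKey l e < lexKey l x)
    (IH : ∀ i, lo' i ≠ T' i → lexKey l x < lexKey l (∑ i', Function.update T' i (lo' i) i') →
      ∃ i₂, lo i₂ ≠ T i₂ ∧ ∑ i', Function.update T' i (lo' i) i' = ∑ i', Function.update T i₂ (lo i₂) i') :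
    ∃ j', lo' j' ≠ T' j' ∧ x = ∑ i, Function.update T' j' (lo' j') i ∧
      coeff (lo j) (f j) / coeff (T j) (f j) = coeff (lo' j') (g j') / coeff (T' j') (g j') := by
  classical
  have hxe : x ≠ e := fun h => by rw [h] at hex; exact lt_irrefl _ hex
  have hz := hzero _ hxe (apply_le_of_lexKey_le l hex.le)
  have hcA0 : ∏ j, coeff (T j) (f j) ≠ 0 := prod_coeff_ne_zero f _ hT
  have hcfx : coeff x (∏ j, f j) = (∏ j, coeff (T j) (f j)) * (coeff (lo j) (f j) / coeff (T j) (f j)) := by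
    rw [hx, coeff_word f hinjf _ (update_mem f T lo hT hlo j), prod_coeff_word f T lo hT hcov _ (update_mem f T lo hT hlo j),
      filter_update T lo hj, Finset.prod_singleton]
  have hρj : coeff (lo j) (f j) / coeff (T j) (f j) ≠ 0 :=
    div_ne_zero (mem_support_iff.1 (hlo j)) (mem_support_iff.1 (hT j))
  have hxg : x ∈ (∏ j, g j).support := by
    rw [mem_support_iff]; intro h; rw [h, add_zero, hcfx] at hz; exact (mul_ne_zero hcA0 hρj) hz
  obtain ⟨a', ha', hsum⟩ := exists_word g hinjg hxg
  have hlt_top : lexKey l x < lexKey l (∑ j, T j) := by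
    rw [hx]
    exact lexKey_sum_lt_T l f T hTmax (update_mem f T lo hT hlo j) (update_ne_T T lo hj)
  by_cases hW0 : (Finset.univ.filter fun i => a' i ≠ T' i) = ∅
  · -- `a'` is the top tuple of `g`: `x = T`, impossible
    have ha'top : a' = T' := funext fun i =>
      eq_T_of_not_mem_filter T' (by rw [hW0]; exact Finset.notMem_empty i)
    rw [ha'top, ← htop] at hsum
    rw [hsum] at hlt_top
    exact absurd hlt_top (lt_irrefl _)
  · obtain ⟨i, hi⟩ := Finset.nonempty_iff_ne_empty.2 hW0
    have hi' : a' i ≠ T' i := ne_T_of_mem_filter T' hi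
    by_cases hW1 : ∀ i₁ ∈ (Finset.univ.filter fun i => a' i ≠ T' i), i₁ = i
    · -- exactly one demoted letter: `x` is the one-letter demotion of `g` at `i`
      have hgi : lo' i ≠ T' i := fun h => hi' (by rw [eq_lo_of_ne g T' lo' hcov' ha' hi', h])
      have ha'eq : a' = Function.update T' i (lo' i) := by
        funext i₁
        rcases eq_or_ne i₁ i with rfl | hne
        · rw [Function.update_self]; exact eq_lo_of_ne g T' lo' hcov' ha' hi'
        · rw [Function.update_of_ne hne]
          exact eq_T_of_not_mem_filter T' (fun h => hne (hW1 i₁ h))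
      rw [ha'eq] at hsum
      refine ⟨i, hgi, hsum.symm, ?_⟩
      have hcgx : coeff x (∏ j, g j) = (∏ j, coeff (T' j) (g j)) * (coeff (lo' i) (g i) / coeff (T' i) (g i)) := by
        rw [← hsum, coeff_word g hinjg _ (update_mem g T' lo' hT' hlo' i), prod_coeff_word g T' lo' hT' hcov' _ (update_mem g T' lo' hT' hlo' i),
          filter_update T' lo' hgi, Finset.prod_singleton]
      have hTc := topCoeff_add_eq_zero l f g T T' hT hT' hinjf hinjg e hzero htop hTe
      rw [hcfx, hcgx] at hz
      have hcB : ∏ j, coeff (T' j) (g j) = -∏ j, coeff (T j) (f j) := eq_neg_of_add_eq_zero_right hTc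
      rw [hcB, neg_mul, ← sub_eq_add_neg, ← mul_sub, mul_eq_zero, sub_eq_zero] at hz
      exact hz.resolve_left hcA0
    · -- at least two demoted letters: all of them are matched, and `x` would be an `f`-word twice
      push Not at hW1
      obtain ⟨i₁, hi₁, hne⟩ := hW1
      have hkey : ∀ i₀ ∈ (Finset.univ.filter fun i => a' i ≠ T' i),
          lexKey l x < lexKey l (∑ i₂, Function.update T' i₀ (lo' i₀) i₂) := by
        intro i₀ hi₀
        rw [← hsum]
        by_cases h : i₀ = i
        · subst h
          exact lexKey_sum_lt_update l g T' lo' hlo' hTmax' hcov' ha' (ne_T_of_mem_filter T' hi₀) (ne_T_of_mem_filter T' hi₁) hne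
        · exact lexKey_sum_lt_update l g T' lo' hlo' hTmax' hcov' ha' (ne_T_of_mem_filter T' hi₀) hi' (Ne.symm h)
      have hlo'ne : ∀ i₀ ∈ (Finset.univ.filter fun i => a' i ≠ T' i), lo' i₀ ≠ T' i₀ := fun i₀ hi₀ h =>
        ne_T_of_mem_filter T' hi₀ (by rw [eq_lo_of_ne g T' lo' hcov' ha' (ne_T_of_mem_filter T' hi₀), h])
      have hIH' : ∀ i₀ ∈ (Finset.univ.filter fun i => a' i ≠ T' i), ∃ i₂, lo i₂ ≠ T i₂ ∧
          ∑ i₃, Function.update T' i₀ (lo' i₀) i₃ = ∑ i₃, Function.update T i₂ (lo i₂) i₃ := fun i₀ hi₀ =>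
        IH i₀ (hlo'ne i₀ hi₀) (hkey i₀ hi₀)
      haveI : Nonempty (Fin m) := ⟨i⟩
      choose! σ hσ using hIH'
      obtain ⟨hinjσ, a₀, hamem, hdset, hι⟩ := transfer f g T lo T' lo' hT hlo hcov hT' hlo' hcov'
        hinjg htop _ σ hlo'ne hσ
      have hιx : emb x = emb (∑ j, T' j) -
          ∑ i₀ ∈ (Finset.univ.filter fun i => a' i ≠ T' i), (emb (T' i₀) - emb (lo' i₀)) := by
        rw [← hsum]; exact emb_sum_word g T' lo' hcov' ha'
      have hsumeq : ∑ i₃, a₀ i₃ = ∑ i₃, Function.update T j (lo j) i₃ := by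
        rw [← hx]; exact emb_injective (by rw [hι, hιx])
      have hweq := hinjf _ _ hamem (update_mem f T lo hT hlo j) hsumeq
      subst hweq
      have hds : (Finset.univ.filter fun i => a' i ≠ T' i).image σ = {j} := by
        rw [← hdset, filter_update T lo hj]
      have hcard := Finset.card_image_of_injOn hinjσ
      rw [hds, Finset.card_singleton] at hcard
      have h2 : 1 < (Finset.univ.filter fun i => a' i ≠ T' i).card := Finset.one_lt_card.2 ⟨i₁, hi₁, i, hi, hne⟩
      omega

/-- **Rigidity lemma.**  Every one-letter demotion point of either frame that lies key-above `e` is matched: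
it is a one-letter demotion point of BOTH frames, with equal coefficient ratios.  (A key-maximal unmatched
such point would contradict `step`, applied to the appropriate side.) -/
theorem matched_of_small (l : (Fin 2 → ℝ) →L[ℝ] ℝ) (f g : Fin m → MvPolynomial (Fin 2) ℂ) (T lo T' lo' : Fin m → (Fin 2 →₀ ℕ))
    (hT : ∀ j, T j ∈ (f j).support) (hlo : ∀ j, lo j ∈ (f j).support)
    (hTmax : ∀ j, ∀ x ∈ (f j).support, lexKey l x ≤ lexKey l (T j))
    (hcov : ∀ j, ∀ x ∈ (f j).support, x = T j ∨ x = lo j)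
    (hT' : ∀ j, T' j ∈ (g j).support) (hlo' : ∀ j, lo' j ∈ (g j).support)
    (hTmax' : ∀ j, ∀ x ∈ (g j).support, lexKey l x ≤ lexKey l (T' j))
    (hcov' : ∀ j, ∀ x ∈ (g j).support, x = T' j ∨ x = lo' j)
    (hinjf : ∀ a b : Fin m → (Fin 2 →₀ ℕ), (∀ j, a j ∈ (f j).support) → (∀ j, b j ∈ (f j).support) →
      ∑ j, a j = ∑ j, b j → a = b)
    (hinjg : ∀ a b : Fin m → (Fin 2 →₀ ℕ), (∀ j, a j ∈ (g j).support) → (∀ j, b j ∈ (g j).support) →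
      ∑ j, a j = ∑ j, b j → a = b)
    (e : Fin 2 →₀ ℕ)
    (hzero : ∀ x : Fin 2 →₀ ℕ, x ≠ e → l (emb e) ≤ l (emb x) → coeff x (∏ j, f j) + coeff x (∏ j, g j) = 0)
    (htop : ∑ j, T j = ∑ j, T' j) (hTe : lexKey l e < lexKey l (∑ j, T j))
    (x : Fin 2 →₀ ℕ) (hex : lexKey l e < lexKey l x)
    (hx : (∃ j, lo j ≠ T j ∧ x = ∑ i, Function.update T j (lo j) i) ∨
      (∃ j', lo' j' ≠ T' j' ∧ x = ∑ i, Function.update T' j' (lo' j') i)) :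
    ∃ j j', lo j ≠ T j ∧ lo' j' ≠ T' j' ∧ x = ∑ i, Function.update T j (lo j) i ∧
      x = ∑ i, Function.update T' j' (lo' j') i ∧
      coeff (lo j) (f j) / coeff (T j) (f j) = coeff (lo' j') (g j') / coeff (T' j') (g j') := by
  classical
  -- the finite set of candidate points, and the bad ones among them
  set Pts : Finset (Fin 2 →₀ ℕ) := (Finset.univ.image fun j => ∑ i, Function.update T j (lo j) i) ∪
    (Finset.univ.image fun j => ∑ i, Function.update T' j (lo' j) i) with hPts
  set Bad : Finset (Fin 2 →₀ ℕ) := Pts.filter fun y => lexKey l e < lexKey l y ∧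
    ((∃ j, lo j ≠ T j ∧ y = ∑ i, Function.update T j (lo j) i) ∨
      (∃ j', lo' j' ≠ T' j' ∧ y = ∑ i, Function.update T' j' (lo' j') i)) ∧
    ¬ ∃ j j', lo j ≠ T j ∧ lo' j' ≠ T' j' ∧ y = ∑ i, Function.update T j (lo j) i ∧
      y = ∑ i, Function.update T' j' (lo' j') i ∧
      coeff (lo j) (f j) / coeff (T j) (f j) = coeff (lo' j') (g j') / coeff (T' j') (g j') with hBad
  have hmemPts : ∀ y, ((∃ j, lo j ≠ T j ∧ y = ∑ i, Function.update T j (lo j) i) ∨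
      (∃ j', lo' j' ≠ T' j' ∧ y = ∑ i, Function.update T' j' (lo' j') i)) → y ∈ Pts := by
    rintro y (⟨j, -, rfl⟩ | ⟨j', -, rfl⟩)
    · exact Finset.mem_union_left _ (Finset.mem_image.2 ⟨j, Finset.mem_univ _, rfl⟩)
    · exact Finset.mem_union_right _ (Finset.mem_image.2 ⟨j', Finset.mem_univ _, rfl⟩)
  by_contra hnot
  have hBne : Bad.Nonempty := ⟨x, Finset.mem_filter.2 ⟨hmemPts x hx, hex, hx, hnot⟩⟩
  obtain ⟨y, hyBad, hymax⟩ := Finset.exists_max_image Bad (lexKey l) hBne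
  obtain ⟨-, hey, hy, hyM⟩ := Finset.mem_filter.1 hyBad
  -- every candidate point key-above `y` is matched
  have hgood : ∀ z, lexKey l y < lexKey l z →
      ((∃ j, lo j ≠ T j ∧ z = ∑ i, Function.update T j (lo j) i) ∨
        (∃ j', lo' j' ≠ T' j' ∧ z = ∑ i, Function.update T' j' (lo' j') i)) →
      ∃ j j', lo j ≠ T j ∧ lo' j' ≠ T' j' ∧ z = ∑ i, Function.update T j (lo j) i ∧
        z = ∑ i, Function.update T' j' (lo' j') i ∧
        coeff (lo j) (f j) / coeff (T j) (f j) = coeff (lo' j') (g j') / coeff (T' j') (g j') := by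
    intro z hz hz'
    by_contra hzM
    have hzBad : z ∈ Bad := Finset.mem_filter.2 ⟨hmemPts z hz', lt_trans hey hz, hz', hzM⟩
    exact absurd (hymax z hzBad) (not_le.2 hz)
  apply hyM
  rcases hy with ⟨j, hj, hyj⟩ | ⟨j', hj', hyj'⟩
  · -- `f`-side point: apply `step`
    have IH : ∀ i, lo' i ≠ T' i → lexKey l y < lexKey l (∑ i', Function.update T' i (lo' i) i') →
        ∃ i₂, lo i₂ ≠ T i₂ ∧
          ∑ i', Function.update T' i (lo' i) i' = ∑ i', Function.update T i₂ (lo i₂) i' := by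
      intro i hi hlt
      obtain ⟨j₁, j₁', hj₁, -, h₁, h₁', -⟩ := hgood _ hlt (Or.inr ⟨i, hi, rfl⟩)
      exact ⟨j₁, hj₁, h₁⟩
    obtain ⟨j', hj', hyj', hρ⟩ := step l f g T lo T' lo' hT hlo hTmax hcov hT' hlo' hTmax' hcov' hinjf hinjg e
      hzero htop hTe hj hyj hey IH
    exact ⟨j, j', hj, hj', hyj, hyj', hρ⟩
  · -- `g`-side point: apply `step` with the frames swapped
    have hzero' : ∀ x : Fin 2 →₀ ℕ, x ≠ e → l (emb e) ≤ l (emb x) →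
        coeff x (∏ j, g j) + coeff x (∏ j, f j) = 0 := fun x hx hle => by rw [add_comm]; exact hzero x hx hle
    have hTe' : lexKey l e < lexKey l (∑ j, T' j) := htop ▸ hTe
    have IH : ∀ i, lo i ≠ T i → lexKey l y < lexKey l (∑ i', Function.update T i (lo i) i') →
        ∃ i₂, lo' i₂ ≠ T' i₂ ∧
          ∑ i', Function.update T i (lo i) i' = ∑ i', Function.update T' i₂ (lo' i₂) i' := by
      intro i hi hlt
      obtain ⟨j₁, j₁', -, hj₁', h₁, h₁', -⟩ := hgood _ hlt (Or.inl ⟨i, hi, rfl⟩)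
      exact ⟨j₁', hj₁', h₁'⟩
    obtain ⟨j, hj, hyj, hρ⟩ := step l g f T' lo' T lo hT' hlo' hTmax' hcov' hT hlo hTmax hcov hinjg hinjf e
      hzero' htop.symm hTe' hj' hyj' hey IH
    exact ⟨j, j', hj, hj', hyj, hyj', hρ.symm⟩

/-- **Step 3 (at most one demoted letter).**  An `f`-word whose sum is the exponent `e` itself (not
cancelled) demotes at most one letter of the top tuple. -/
theorem card_filter_le_one (l : (Fin 2 → ℝ) →L[ℝ] ℝ) (f g : Fin m → MvPolynomial (Fin 2) ℂ) (T lo T' lo' : Fin m → (Fin 2 →₀ ℕ))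
    (hT : ∀ j, T j ∈ (f j).support) (hlo : ∀ j, lo j ∈ (f j).support)
    (hTmax : ∀ j, ∀ x ∈ (f j).support, lexKey l x ≤ lexKey l (T j))
    (hcov : ∀ j, ∀ x ∈ (f j).support, x = T j ∨ x = lo j)
    (hT' : ∀ j, T' j ∈ (g j).support) (hlo' : ∀ j, lo' j ∈ (g j).support)
    (hTmax' : ∀ j, ∀ x ∈ (g j).support, lexKey l x ≤ lexKey l (T' j))
    (hcov' : ∀ j, ∀ x ∈ (g j).support, x = T' j ∨ x = lo' j)
    (hinjf : ∀ a b : Fin m → (Fin 2 →₀ ℕ), (∀ j, a j ∈ (f j).support) → (∀ j, b j ∈ (f j).support) →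
      ∑ j, a j = ∑ j, b j → a = b)
    (hinjg : ∀ a b : Fin m → (Fin 2 →₀ ℕ), (∀ j, a j ∈ (g j).support) → (∀ j, b j ∈ (g j).support) →
      ∑ j, a j = ∑ j, b j → a = b)
    (e : Fin 2 →₀ ℕ)
    (hzero : ∀ x : Fin 2 →₀ ℕ, x ≠ e → l (emb e) ≤ l (emb x) → coeff x (∏ j, f j) + coeff x (∏ j, g j) = 0)
    (htop : ∑ j, T j = ∑ j, T' j) (hTe : lexKey l e < lexKey l (∑ j, T j))
    {a : Fin m → (Fin 2 →₀ ℕ)} (ha : ∀ j, a j ∈ (f j).support) (hea : ∑ j, a j = e)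
    (he : coeff e (∏ j, f j) + coeff e (∏ j, g j) ≠ 0) :
    (Finset.univ.filter fun i => a i ≠ T i).card ≤ 1 := by
  classical
  by_contra hgt
  push Not at hgt
  obtain ⟨i, hi, i', hi', hne⟩ := Finset.one_lt_card.1 hgt
  have hlone : ∀ i₀ ∈ (Finset.univ.filter fun i => a i ≠ T i), lo i₀ ≠ T i₀ := fun i₀ hi₀ h =>
    ne_T_of_mem_filter T hi₀ (by rw [eq_lo_of_ne f T lo hcov ha (ne_T_of_mem_filter T hi₀), h])
  -- every demoted coordinate of `a` gives a demotion point key-above `e`, hence matched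
  have hkey : ∀ i₀ ∈ (Finset.univ.filter fun i => a i ≠ T i),
      lexKey l e < lexKey l (∑ i₁, Function.update T i₀ (lo i₀) i₁) := by
    intro i₀ hi₀
    rw [← hea]
    by_cases h : i₀ = i
    · subst h
      exact lexKey_sum_lt_update l f T lo hlo hTmax hcov ha (ne_T_of_mem_filter T hi₀) (ne_T_of_mem_filter T hi') hne.symm
    · exact lexKey_sum_lt_update l f T lo hlo hTmax hcov ha (ne_T_of_mem_filter T hi₀) (ne_T_of_mem_filter T hi) (Ne.symm h)
  have hM : ∀ i₀ ∈ (Finset.univ.filter fun i => a i ≠ T i), ∃ i₂, (lo' i₂ ≠ T' i₂ ∧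
      ∑ i₁, Function.update T i₀ (lo i₀) i₁ = ∑ i₁, Function.update T' i₂ (lo' i₂) i₁) ∧
      coeff (lo i₀) (f i₀) / coeff (T i₀) (f i₀) = coeff (lo' i₂) (g i₂) / coeff (T' i₂) (g i₂) := by
    intro i₀ hi₀
    obtain ⟨j, j', hj, hj', h₁, h₁', hρ⟩ := matched_of_small l f g T lo T' lo' hT hlo hTmax hcov hT' hlo' hTmax'
      hcov' hinjf hinjg e hzero htop hTe _ (hkey i₀ hi₀) (Or.inl ⟨i₀, hlone i₀ hi₀, rfl⟩)
    have hji : i₀ = j := update_sum_injective f T lo hT hlo hinjf (hlone i₀ hi₀) h₁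
    subst hji
    exact ⟨j', ⟨hj', h₁'⟩, hρ⟩
  haveI : Nonempty (Fin m) := ⟨i⟩
  choose! τ hτ hρτ using hM
  obtain ⟨hinjτ, a₀, hamem, hdset, hι⟩ := transfer g f T' lo' T lo hT' hlo' hcov' hT hlo hcov
    hinjf htop.symm _ τ hlone hτ
  -- the transferred `g`-word has sum `e`
  have hsum'' : ∑ i₁, a₀ i₁ = e := by
    apply emb_injective
    rw [hι, ← hea, emb_sum_word f T lo hcov ha]
  -- coefficients: `c_A Π ρ + c_B Π ρ = 0`
  have hcf : coeff e (∏ j, f j) = (∏ j, coeff (T j) (f j)) *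
      ∏ i₀ ∈ (Finset.univ.filter fun i => a i ≠ T i), (coeff (lo i₀) (f i₀) / coeff (T i₀) (f i₀)) := by
    rw [← hea, coeff_word f hinjf _ ha, prod_coeff_word f T lo hT hcov _ ha]
  have hcg : coeff e (∏ j, g j) = (∏ j, coeff (T' j) (g j)) *
      ∏ i₀ ∈ (Finset.univ.filter fun i => a i ≠ T i), (coeff (lo i₀) (f i₀) / coeff (T i₀) (f i₀)) := by
    rw [← hsum'', coeff_word g hinjg _ hamem, prod_coeff_word g T' lo' hT' hcov' _ hamem, hdset, Finset.prod_image hinjτ]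
    congr 1
    exact Finset.prod_congr rfl fun i₀ hi₀ => (hρτ i₀ hi₀).symm
  have hTc := topCoeff_add_eq_zero l f g T T' hT hT' hinjf hinjg e hzero htop hTe
  apply he
  rw [hcf, hcg, ← add_mul, hTc, zero_mul]

end Rigidity

end

end Summit.ValiantsHypothesis.ValiantsHypothesis.Theorems.NewtonFramesTwoProducts.FrameRungTwoBinomial
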